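import Summits.QuantumFields.YangMills.Theorems.BalabanLadderIRHereditaryUpgrade
import Summits.QuantumFields.YangMills.Theorems.OneCertifiedCubeFiniteSizeCriterionTorus
import HarnessLib

/-!
# `IR` — the TORUS UPGRADE: single-cell sup-`ζ` rarity ⇒ the torus anchor (iii_T) (torus DLR transfer)

Spine route `BalabanLadder` (route-QuantumFields-BalabanLadder), crux `IR` (stmt-QuantumFields-19354), registered line
«af-pincer-T» (skeleton 0308f95ca6f6a115), clause **(iii_T)** of `AfPincerT.TypShellCond` (torus anchor: on every odd
torus `2S+1 ≥ 4b` the periodic Wilson state makes all cells of a prescribed family inside the fundamental domain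
atypical with probability `≤ δ ^ #F`); owner READING R37 (d) (`pub/ym-beyond/p2-g26-files/READINGS-R36-R42-g26.md`):
«`TorusUpgrade` MAY LAND as a count-neutral helper (serves ANY Typ)».  Count-neutral helper
(`--supports stmt-QuantumFields-19354 --as helper`); no stub is claimed, no skeleton touched.

## Statement (`torusJointRarity_of_supCellRarity`)

For a continuous representation `ρ` of a compact second-countable group, a mesh-`b` frame `w` (`b ≥ 1`), a cell-local
measurable assignment `Typ` and `0 ≤ δ`: if ONE resampled cell is atypical with probability at most `δ` under EVERY
exterior — `γ_{regionEdges w {c}}(ζ)((Typ c)ᶜ) ≤ ofReal δ` for all `c, ζ` (single-cell sup-`ζ` rarity for the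
lattice Yang–Mills kernels `ymSpecification ρ β` of `ℤ⁴`) — then clause (iii_T) holds VERBATIM with the same `δ`:
for every `S` with `4b ≤ 2S+1` and every finite set `F` of cells inside the fundamental domain `[-S, S]⁴`,
`μ_{2S+1, β}{V | ∀ c ∈ F, torusLift V ∉ Typ c} ≤ ofReal (δ ^ #F)`.

## Proof (one torus DLR step per cell; no reflection positivity, no chessboard)

Induct on `F`.  For `F = insert c₀ F₀` apply the tree's far-factor torus DLR identity
`FiniteSizeCriterion.integral_torusLift_mul_eq_integral_ymSpecification_mul_of_measurable` (Georgii 2011 Thm. 4.17 /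
(4.18)) with volume `Λ = cellEdges w c₀`, near observable `f = 1_{(Typ c₀)ᶜ}` (a cylinder on `Λ`) and far factor
`H = 1[all cells of F₀ atypical]`, which does not feel the resampling of the torus links over `Λ` (the cells of `F₀`
are disjoint from `c₀` and, like `c₀`, sit inside the fundamental domain, where reduction mod `2S+1` is injective).
The geometric input is that `Λ` together with its plaquette collar has base points within sup-distance `b+1` of the
cell centre and `2(b+1) < 2S+1` (from `4b ≤ 2S+1`, `b ≥ 1`), so it injects into the torus.  The identity turns
`μ(all of F atypical) = ∫ f(lift V) H(V) dμ` into `∫ γ_Λ(lift V)((Typ c₀)ᶜ) · H(V) dμ ≤ δ · μ(all of F₀ atypical)`.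

Everything here is proved (no `sorry`, no new axioms).  HONEST FRAMING: soft torus-DLR bookkeeping; it makes (iii_T)
FREE given single-cell sup-`ζ` rarity of a candidate `Typ` — the rarity itself, (i_T) and the bridge `TypCriterion`
carry the weight of the line; the conditional chain (Track A) is untouched; not a gap, not Clay.
Refs: Georgii 2011 Thm. 4.17, (4.18), Def. 1.23; Friedli–Velenik 2017 Lemma 6.7, (6.34); Seiler LNP 159 Ch. 2.
-/

set_option autoImplicit false

noncomputable section

open MeasureTheory
open scoped ENNReal
open Literature.Probability.LatticeModels
open Literature.MathematicalPhysics.QuantumLattice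
open Literature.MathematicalPhysics.QuantumFieldTheory (GaugeConfig wilsonMeasure isProbabilityMeasure_wilsonMeasure
  measurable_torusLift)
open Summit.QuantumFields.YangMills.Cruxes.IR.Tempered (cellEdges regionEdges)
open Summit.QuantumFields.YangMills.Theorems.FiniteSizeCriterion
  (integral_torusLift_mul_eq_integral_ymSpecification_mul_of_measurable)

namespace Summit.QuantumFields.YangMills.Theorems.IRRarityUpgrade

/-! ## §1 Cell geometry inside the fundamental domain -/

section Geometry

variable {V S C : Type*}

/-- The all-atypical event of `F` is decided by the spins in the cells of `F`. -/
theorem dependsOn_allAtypical [DecidableEq V] (cells : C → Finset V) {Typ : C → Set (V → S)}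
    (hTd : ∀ c, DependsOn (fun σ : V → S => σ ∈ Typ c) (↑(cells c) : Set V)) (F : Finset C) :
    DependsOn (fun σ : V → S => σ ∈ {σ : V → S | ∀ c ∈ F, σ ∉ Typ c}) (↑(F.biUnion cells) : Set V) := by
  intro σ τ hστ
  have hc : ∀ c ∈ F, (σ ∈ Typ c) = (τ ∈ Typ c) := fun c hc =>
    hTd c fun i hi => hστ i (Finset.mem_coe.2 (Finset.mem_biUnion.2 ⟨c, hc, Finset.mem_coe.1 hi⟩))
  simp only [Set.mem_setOf_eq]
  exact propext (forall₂_congr fun c hcF => by rw [hc c hcF])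

variable {w : Fin 4 → ℤ → ℤ} {b : ℕ}

/-- An edge of a cell inside the fundamental domain `[-S, S]⁴` is based in the centred box. -/
theorem fst_mem_box_of_mem_cellEdges {c : Fin 4 → ℤ} {S : ℕ}
    (hin : ∀ i, -(S : ℤ) ≤ w i (c i) ∧ w i (c i + 1) ≤ (S : ℤ) + 1) {e : ZdEdge 4} (he : e ∈ cellEdges w c) :
    e.1 ∈ box 4 S := by
  simp only [Summit.QuantumFields.YangMills.Cruxes.IR.Tempered.cellEdges, Finset.mem_product,
    Fintype.mem_piFinset, Finset.mem_Ico, Finset.mem_univ, and_true] at he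
  rw [mem_box]
  intro i
  have := he i; have := hin i
  constructor <;> omega

/-- The base points of a mesh-`b` cell and of its plaquette collar lie within sup-distance `b + 1` of the point
`(w i (c i) + b)_i`. -/
theorem near_of_mem_cell_collar
    (hw : ∀ i j, w i j + ((b : ℕ) : ℤ) ≤ w i (j + 1) ∧ w i (j + 1) ≤ w i j + 2 * ((b : ℕ) : ℤ))
    (c : Fin 4 → ℤ) {x : Site 4}
    (hx : x ∈ ((cellEdges w c ∪ cellEdges w c ∪
      (plaquettesTouching (cellEdges w c)).biUnion plaquetteEdges).image Prod.fst : Finset (Site 4))) :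
    ∀ j, |x j - (w j (c j) + b)| ≤ (b : ℤ) + 1 := by
  classical
  have hcell : ∀ e ∈ cellEdges w c, ∀ j, |e.1 j - (w j (c j) + b)| ≤ (b : ℤ) := by
    intro e he j
    simp only [Summit.QuantumFields.YangMills.Cruxes.IR.Tempered.cellEdges, Finset.mem_product,
      Fintype.mem_piFinset, Finset.mem_Ico, Finset.mem_univ, and_true] at he
    have := he j; have := (hw j (c j)).2
    rw [abs_le]; constructor <;> omega
  obtain ⟨e, he, rfl⟩ := Finset.mem_image.1 hx
  intro j
  rcases Finset.mem_union.1 he with h | h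
  · rw [Finset.union_idempotent] at h
    have := hcell e h j
    have hb : (0 : ℤ) ≤ b := by positivity
    exact this.trans (by omega)
  · obtain ⟨e₀, he₀, hnear⟩ := exists_near_of_mem_plaquettesTouching_biUnion h
    have h1 := hcell e₀ he₀ j
    have h2 := hnear j
    calc |e.1 j - (w j (c j) + b)| = |(e.1 j - e₀.1 j) + (e₀.1 j - (w j (c j) + b))| := by ring_nf
      _ ≤ |e.1 j - e₀.1 j| + |e₀.1 j - (w j (c j) + b)| := abs_add_le _ _
      _ ≤ 1 + b := add_le_add h2 h1
      _ = (b : ℤ) + 1 := by ring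

/-- A mesh-`b` cell with `b ≥ 1`, together with its plaquette collar, injects into every torus of side
`2S+1 ≥ 4b`. -/
theorem injOn_proj_cell_collar
    (hw : ∀ i j, w i j + ((b : ℕ) : ℤ) ≤ w i (j + 1) ∧ w i (j + 1) ≤ w i j + 2 * ((b : ℕ) : ℤ))
    (hb : 1 ≤ b) {S : ℕ} (hS : 4 * b ≤ 2 * S + 1) (c : Fin 4 → ℤ) :
    Set.InjOn (Torus.proj (2 * S + 1))
      (((cellEdges w c ∪ cellEdges w c ∪
        (plaquettesTouching (cellEdges w c)).biUnion plaquetteEdges).image Prod.fst : Finset (Site 4)) :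
        Set (Site 4)) := by
  have hϱ : 2 * ((b : ℤ) + 1) < ((2 * S + 1 : ℕ) : ℤ) := by push_cast; omega
  refine (injOn_torusProj_of_near (M := 2 * S + 1) (fun j => w j (c j) + b) hϱ).mono fun x hx => ?_
  exact near_of_mem_cell_collar hw c (Finset.mem_coe.1 hx)

/-- Edges of two distinct cells inside the fundamental domain have distinct images in the torus of side `2S+1`. -/
theorem torusEdge_ne_of_mem_cellEdges
    (hw : ∀ i j, w i j + ((b : ℕ) : ℤ) ≤ w i (j + 1) ∧ w i (j + 1) ≤ w i j + 2 * ((b : ℕ) : ℤ))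
    {S : ℕ} {c c' : Fin 4 → ℤ} (hcc : c ≠ c')
    (hc : ∀ i, -(S : ℤ) ≤ w i (c i) ∧ w i (c i + 1) ≤ (S : ℤ) + 1)
    (hc' : ∀ i, -(S : ℤ) ≤ w i (c' i) ∧ w i (c' i + 1) ≤ (S : ℤ) + 1)
    {e e' : ZdEdge 4} (he : e ∈ cellEdges w c) (he' : e' ∈ cellEdges w c') :
    torusEdge (2 * S + 1) e ≠ torusEdge (2 * S + 1) e' := by
  intro h
  simp only [torusEdge, Prod.mk.injEq] at h
  obtain ⟨h1, h2⟩ := h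
  have h3 : e.1 = e'.1 :=
    torusProj_injOn_box (by omega) (fst_mem_box_of_mem_cellEdges hc he) (fst_mem_box_of_mem_cellEdges hc' he') h1
  have hee : e = e' := Prod.ext h3 h2
  subst hee
  exact Finset.disjoint_left.1 (disjoint_cellEdges (OddTorusChessboard.grid_monotone hw) hcc) he he'

end Geometry

/-! ## §2 The torus upgrade -/

section YangMills

variable {G : Type} [Group G] [TopologicalSpace G] [IsTopologicalGroup G] [CompactSpace G]
  [MeasurableSpace G] [BorelSpace G] [SecondCountableTopology G]
  {N : ℕ} (ρ : G →* Matrix (Fin N) (Fin N) ℂ)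

/-- **Torus upgrade (one induction step = one torus DLR step), `measureReal` form.**  Under single-cell sup-`ζ`
rarity, for cells of `F` inside the fundamental domain of the torus of side `2S+1 ≥ 4b` (`b ≥ 1`),
`μ.real {V | ∀ c ∈ F, torusLift V ∉ Typ c} ≤ δ ^ #F`. -/
theorem measureReal_allAtypical_torus_le_pow (hρ : Continuous ρ) (β : ℝ) {b : ℕ} (hb : 1 ≤ b)
    {w : Fin 4 → ℤ → ℤ}
    (hw : ∀ i j, w i j + ((b : ℕ) : ℤ) ≤ w i (j + 1) ∧ w i (j + 1) ≤ w i j + 2 * ((b : ℕ) : ℤ))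
    {Typ : (Fin 4 → ℤ) → Set (LGConfig 4 G)} (hTm : ∀ c, MeasurableSet (Typ c))
    (hTd : ∀ c, DependsOn (fun σ : LGConfig 4 G => σ ∈ Typ c) ↑(cellEdges w c)) {δ : ℝ} (hδ : 0 ≤ δ)
    (h1 : ∀ (c : Fin 4 → ℤ) (ζ : LGConfig 4 G),
      (ymSpecification ρ β (regionEdges w {c}) ζ) (Typ c)ᶜ ≤ ENNReal.ofReal δ)
    {S : ℕ} (hS : 4 * b ≤ 2 * S + 1) (F : Finset (Fin 4 → ℤ))
    (hF : ∀ c ∈ F, ∀ i, -(S : ℤ) ≤ w i (c i) ∧ w i (c i + 1) ≤ (S : ℤ) + 1) :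
    (wilsonMeasure (d := 4) (L := 2 * S + 1) ρ β).real
        {V : GaugeConfig 4 (2 * S + 1) G | ∀ c ∈ F, torusLift (2 * S + 1) V ∉ Typ c} ≤ δ ^ F.card := by
  classical
  set L : ℕ := 2 * S + 1 with hL
  set μ : Measure (GaugeConfig 4 L G) := wilsonMeasure (d := 4) (L := L) ρ β with hμ
  haveI : IsProbabilityMeasure μ := isProbabilityMeasure_wilsonMeasure (d := 4) (L := L) ρ hρ β
  -- the all-atypical events on `ℤ⁴` and on the torus
  let E : Finset (Fin 4 → ℤ) → Set (LGConfig 4 G) := fun F => {σ | ∀ c ∈ F, σ ∉ Typ c}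
  have hEm : ∀ F, MeasurableSet (E F) := fun F => measurableSet_allAtypical hTm F
  have hET : ∀ F : Finset (Fin 4 → ℤ),
      {V : GaugeConfig 4 L G | ∀ c ∈ F, torusLift L V ∉ Typ c} = torusLift L ⁻¹' E F := fun F => rfl
  have hETm : ∀ F : Finset (Fin 4 → ℤ),
      MeasurableSet {V : GaugeConfig 4 L G | ∀ c ∈ F, torusLift L V ∉ Typ c} := fun F =>
    (hEm F).preimage (measurable_torusLift L)
  -- single-cell rarity in `measureReal` form
  have h1' : ∀ (c : Fin 4 → ℤ) (ζ : LGConfig 4 G), (ymSpecification ρ β (cellEdges w c) ζ).real (Typ c)ᶜ ≤ δ :=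
    fun c ζ => ENNReal.toReal_le_of_le_ofReal hδ (by rw [← regionEdges_singleton w c]; exact h1 c ζ)
  -- induction on `F`
  induction F using Finset.induction_on with
  | empty => simp
  | @insert c₀ F₀ hc₀ ih =>
    have hF₀ : ∀ c ∈ F₀, ∀ i, -(S : ℤ) ≤ w i (c i) ∧ w i (c i + 1) ≤ (S : ℤ) + 1 := fun c hc =>
      hF c (Finset.mem_insert_of_mem hc)
    have hc₀in : ∀ i, -(S : ℤ) ≤ w i (c₀ i) ∧ w i (c₀ i + 1) ≤ (S : ℤ) + 1 := hF c₀ (Finset.mem_insert_self c₀ F₀)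
    have ih' := ih hF₀
    rw [Finset.card_insert_of_notMem hc₀, pow_succ']
    -- the near observable and the far factor
    set Λ : Finset (ZdEdge 4) := cellEdges w c₀ with hΛ
    set f : LGConfig 4 G → ℝ := ((Typ c₀)ᶜ).indicator 1 with hf
    set H : GaugeConfig 4 L G → ℝ := fun V => (E F₀).indicator 1 (torusLift L V) with hH
    have hfm : Measurable f := measurable_one.indicator (hTm c₀).compl
    have hfC : ∀ U, |f U| ≤ 1 := fun U => by
      by_cases hU : U ∈ (Typ c₀)ᶜ <;> simp [hf, hU]
    have hfS : IsCylinder f Λ := by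
      intro U U' hUU'
      have h := hTd c₀ hUU'
      simp only [hf, Set.indicator_apply, Set.mem_compl_iff, eq_iff_iff, Pi.one_apply] at h ⊢
      simp only [h]
    have hHm : Measurable H := (measurable_one.indicator (hEm F₀)).comp (measurable_torusLift L)
    have hHD : ∀ V, |H V| ≤ 1 := fun V => by
      by_cases hV : torusLift L V ∈ E F₀ <;> simp [hH, hV]
    have hH0 : ∀ V, 0 ≤ H V := fun V => by
      by_cases hV : torusLift L V ∈ E F₀ <;> simp [hH, hV]
    have hHinv : ∀ W V, H ((Λ.image (torusEdge L)).piecewise W V) = H V := by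
      intro W V
      simp only [hH]
      refine apply_torusLift_piecewise_eq (T := F₀.biUnion (cellEdges w))
        (g := (E F₀).indicator (1 : LGConfig 4 G → ℝ)) ?_ ?_ W V
      · intro U U' hUU'
        have h : (U ∈ E F₀) = (U' ∈ E F₀) := dependsOn_allAtypical (cellEdges w) hTd F₀ hUU'
        by_cases hU : U ∈ E F₀
        · have hU' : U' ∈ E F₀ := h ▸ hU
          rw [Set.indicator_of_mem hU, Set.indicator_of_mem hU', Pi.one_apply, Pi.one_apply]
        · have hU' : U' ∉ E F₀ := fun h' => hU (h.symm ▸ h')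
          rw [Set.indicator_of_notMem hU, Set.indicator_of_notMem hU']
      · intro e he e' he'
        obtain ⟨c, hc, hec⟩ := Finset.mem_biUnion.1 he
        have hne : c ≠ c₀ := fun h => hc₀ (h ▸ hc)
        exact torusEdge_ne_of_mem_cellEdges hw hne (hF₀ c hc) hc₀in hec he'
    -- the torus DLR identity with the far factor `H`
    have hdlr := integral_torusLift_mul_eq_integral_ymSpecification_mul_of_measurable ρ hρ β Λ hfm hfC hfS
      (L := L) (injOn_proj_cell_collar hw hb hS c₀) hHm hHD hHinv
    -- left-hand side: the all-atypical event of `insert c₀ F₀`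
    have hlhs : ∫ V, f (torusLift L V) * H V ∂μ =
        μ.real {V : GaugeConfig 4 L G | ∀ c ∈ insert c₀ F₀, torusLift L V ∉ Typ c} := by
      rw [← integral_indicator_one (hETm _)]
      refine integral_congr_ae (Filter.Eventually.of_forall fun V => ?_)
      simp only [hf, hH, Set.indicator_apply, Set.mem_compl_iff, Set.mem_setOf_eq, Finset.forall_mem_insert,
        Pi.one_apply, mul_ite, mul_one, mul_zero]
      by_cases h0 : torusLift L V ∈ Typ c₀ <;> by_cases h2 : ∀ c ∈ F₀, torusLift L V ∉ Typ c <;> simp [h0, h2, E]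
    -- right-hand side: the kernel mean is at most `δ`
    have hrhs : ∫ V, (∫ U, f U ∂(ymSpecification ρ β Λ (torusLift L V))) * H V ∂μ ≤
        ∫ V, δ * H V ∂μ := by
      refine integral_mono_of_nonneg (Filter.Eventually.of_forall fun V => ?_) ?_
        (Filter.Eventually.of_forall fun V => ?_)
      · exact mul_nonneg (integral_nonneg fun U => Set.indicator_nonneg (fun _ _ => zero_le_one) U) (hH0 V)
      · exact (Literature.MathematicalPhysics.QuantumLattice.integrable_of_abs_le hHm hHD).const_mul δ
      · have hker : ∫ U, f U ∂(ymSpecification ρ β Λ (torusLift L V)) ≤ δ := by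
          rw [hf, integral_indicator_one (hTm c₀).compl]
          exact h1' c₀ (torusLift L V)
        exact mul_le_mul_of_nonneg_right hker (hH0 V)
    have hδH : ∫ V, δ * H V ∂μ = δ * μ.real {V : GaugeConfig 4 L G | ∀ c ∈ F₀, torusLift L V ∉ Typ c} := by
      rw [integral_const_mul, hH]
      congr 1
      rw [← integral_indicator_one (hETm F₀)]
      rfl
    calc μ.real {V : GaugeConfig 4 L G | ∀ c ∈ insert c₀ F₀, torusLift L V ∉ Typ c}
        = ∫ V, f (torusLift L V) * H V ∂μ := hlhs.symm
      _ = ∫ V, (∫ U, f U ∂(ymSpecification ρ β Λ (torusLift L V))) * H V ∂μ := hdlr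
      _ ≤ ∫ V, δ * H V ∂μ := hrhs
      _ = δ * μ.real {V : GaugeConfig 4 L G | ∀ c ∈ F₀, torusLift L V ∉ Typ c} := hδH
      _ ≤ δ * δ ^ F₀.card := mul_le_mul_of_nonneg_left ih' hδ

/-- **Clause (iii_T) of `TypShellCond` from single-cell sup-`ζ` rarity (the torus upgrade).**  Verbatim the (iii_T)
conjunct of `AfPincerT.TypShellCond` for the given `Typ` and `δ`: on every torus of side `2S+1 ≥ 4b` (`b ≥ 1`), for
every non-empty finite set `F` of cells inside the fundamental domain `[-S, S]⁴`, the periodic Wilson state makes all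
cells of `F` atypical with probability `≤ ofReal (δ ^ #F)` (certideate-2's `TorusUpgrade`/`TorusJointRarity` shape). -/
theorem torusJointRarity_of_supCellRarity (hρ : Continuous ρ) (β : ℝ) {b : ℕ} (hb : 1 ≤ b)
    {w : Fin 4 → ℤ → ℤ}
    (hw : ∀ i j, w i j + ((b : ℕ) : ℤ) ≤ w i (j + 1) ∧ w i (j + 1) ≤ w i j + 2 * ((b : ℕ) : ℤ))
    {Typ : (Fin 4 → ℤ) → Set (LGConfig 4 G)} (hTm : ∀ c, MeasurableSet (Typ c))
    (hTd : ∀ c, DependsOn (fun σ : LGConfig 4 G => σ ∈ Typ c) ↑(cellEdges w c)) {δ : ℝ} (hδ : 0 ≤ δ)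
    (h1 : ∀ (c : Fin 4 → ℤ) (ζ : LGConfig 4 G),
      (ymSpecification ρ β (regionEdges w {c}) ζ) (Typ c)ᶜ ≤ ENNReal.ofReal δ) :
    ∀ S : ℕ, 4 * b ≤ 2 * S + 1 → ∀ F : Finset (Fin 4 → ℤ), F.Nonempty →
      (∀ c ∈ F, ∀ i, -(S : ℤ) ≤ w i (c i) ∧ w i (c i + 1) ≤ (S : ℤ) + 1) →
        (wilsonMeasure (d := 4) (L := 2 * S + 1) ρ β)
            {V : GaugeConfig 4 (2 * S + 1) G | ∀ c ∈ F, torusLift (2 * S + 1) V ∉ Typ c} ≤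
          ENNReal.ofReal (δ ^ F.card) := by
  intro S hS F _ hF
  haveI : IsProbabilityMeasure (wilsonMeasure (d := 4) (L := 2 * S + 1) (G := G) ρ β) :=
    isProbabilityMeasure_wilsonMeasure (d := 4) (L := 2 * S + 1) ρ hρ β
  rw [ENNReal.le_ofReal_iff_toReal_le (measure_ne_top _ _) (pow_nonneg hδ _)]
  exact measureReal_allAtypical_torus_le_pow ρ hρ β hb hw hTm hTd hδ h1 hS F hF

end YangMills

end Summit.QuantumFields.YangMills.Theorems.IRRarityUpgrade

end
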